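import Summits.CriticalPhenomena.PercolationContinuityZ3.Theorems.PercNearOneGluingNoHeavyLowerTailAntipodalR1ApexAdjacent
import HarnessLib

/-!
# ANTI₁ for the `b`-regional part of the left family (the region-keyed Reimer certificate)

Support file for `stmt-CriticalPhenomena-4575` (memo `prim-gen-kcluster/KCLUSTER-gen75.md` §1; conjecture
ANTI₁ of `KCLUSTER-gen52.md` §3).  No definitions, no named facts, no sorries.  Vocabulary of `AntipodalR1`
(`clus`, `region`, `freeNbr`, `lSet`, `rSet`, `tSet`; gen 62), the Reimer-certificate theorem
`ReimerCertificate.card_le_of_certificate` and the forcing lemma `AntipodalR1.cylinder_subset_rSet` (gen 74).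

For a colouring `x` write `C = K_a(x)` for the closed cluster of the apex and `Q_b(x) = region ends x a b`
for the region of `b`: the vertices joined to `b` by a path of the support graph avoiding `C`.  Call an
edge *`b`-regional* for `x` if one of its ends lies in `Q_b(x)`, and call `x ∈ L` **`b`-regional** if `a`
is joined to `b` by an open path all of whose edges are `b`-regional (formally: a `ReflTransGen` chain from
`a` to `b` whose steps are open edges with an end in `Q_b(x)`).

**Theorem** (`AntipodalR1.card_filter_regional_le_card_rSet`).  For every finite multigraph
`ends : ι → Sym2 V` and vertices `a, b, c`:
`#{x ∈ L : x is b-regional} ≤ #R(b,c) = #{x : b ∈ O_a ∖ K_a, c ∈ K_a ∖ O_a}`.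

If `a ~ b` then every `x ∈ L` is `b`-regional (the edge `ab` is open, else `b ∈ K_a`, and it is incident to
`b ∈ Q_b(x)`), so the theorem contains gen 74's `card_lSet_le_card_rSet_of_adj_left`
(`lSet_filter_regional_eq_of_adj`); in general it settles ANTI₁ for
the regional part of `L` (74 % of all elements over the 2-connected graphs with `n ≤ 6`, gen-75 census
`work/code/rulecheck.py regb`), unconditionally and for every instance.

**Certificate.**  Classes := the pattern of `x` on the `b`-regional edges of `x` (`e ↦ some (x e)` there,
`none` elsewhere); flip set `T(x)` := the open edges of `x` that are not `b`-regional (close everything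
open outside `E(Q_b) ∪ ∂Q_b`); all targets `R(b,c)`.  The four forcing conditions are proved exactly as in
gen 74's apex-adjacent certificate with the closed cluster `K_b(x)` replaced by the region `Q_b(x)`:
(F1) is the regionality hypothesis, (F2) holds because every edge entering `Q_b(x₁)` comes from
`K_a(x₁)` and is open, (F3)/(F4) use that class-mates have the same region (`region_eq_of_key`) and that
a support step out of a region lands in the closed cluster of the apex.  The new point is (D): the
region is *decodable from every cylinder point* — if `z` agrees with `x₁` on the `b`-regional edges of
`x₁` and every closed edge of `x₃` is closed in `z`, then `K_a(x₃)` misses `Q_b(x₁)`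
(`clusA_disjoint_region_of_agree`), whence `Q_b(x₁) ⊆ Q_b(x₃)` (`region_subset_of_disjoint`); for a
common cylinder point of two classes both inclusions hold, the regions coincide and so do the patterns.
No exit-edge argument and no hypothesis on the graph are needed.  Verified numerically before
formalisation (gen-75 `rulecheck.py regb`: 464 + 1 698 + 1 072 + 1 874 + 5 412 instances on 2-connected /
connected graphs `n ≤ 8` and multigraphs `n ≤ 6`: 0 bad cylinder points, 0 overlaps). [this work]
-/

namespace Summit.CriticalPhenomena.PercolationContinuityZ3.Theorems

namespace AntipodalR1

open Finset Relation

variable {V ι : Type*}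

/-! ### Regions: decodability -/

/-- **The closed cluster of another colouring misses the region.**  Let `b ∉ K_a(x₁)`.  If a colouring
`z` agrees with `x₁` on every edge incident to the region `Q_b(x₁)`, and every closed edge of a colouring
`x₃` is closed in `z`, then `K_a(x₃) ∩ Q_b(x₁) = ∅`: a closed path of `x₃` from `a` would enter the region
through an edge that is closed in `z`, hence closed in `x₁`, from a vertex which is then outside `K_a(x₁)`
and therefore inside the region. [this work] -/
theorem clusA_disjoint_region_of_agree {ends : ι → Sym2 V} {x₁ x₃ z : ι → Bool} {a b : V}
    (hKb : b ∉ clus ends x₁ false a)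
    (hz₁ : ∀ e u w, ends e = s(u, w) → u ∈ region ends x₁ a b → z e = x₁ e)
    (hz₃ : ∀ e, x₃ e = false → z e = false) {v : V} (hv : v ∈ clus ends x₃ false a) :
    v ∉ region ends x₁ a b := by
  rw [mem_clus] at hv
  induction hv with
  | refl => exact fun h => not_mem_clus_of_region hKb (mem_region.1 h) ReflTransGen.refl
  | @tail u w _ huw ih =>
    intro hw
    obtain ⟨e, hx₃e, hends⟩ := huw
    have hze : z e = false := hz₃ e hx₃e
    have hx₁e : x₁ e = false := by rw [← hz₁ e w u (by rw [hends, Sym2.eq_swap]) hw]; exact hze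
    have hwK : w ∉ clus ends x₁ false a := not_mem_clus_of_region hKb (mem_region.1 hw)
    have huK : u ∉ clus ends x₁ false a := fun h => hwK (clus_step h ⟨e, hx₁e, hends⟩)
    exact ih (mem_region_step hKb hw (by rw [hends, Sym2.eq_swap]) huK)

/-- **A region avoiding a closed cluster lies in the corresponding region**: if `K_a(x₃)` misses
`Q_b(x₁)` then `Q_b(x₁) ⊆ Q_b(x₃)`. [this work] -/
theorem region_subset_of_disjoint {ends : ι → Sym2 V} {x₁ x₃ : ι → Bool} {a b : V}
    (h : ∀ v, v ∈ clus ends x₃ false a → v ∉ region ends x₁ a b) :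
    region ends x₁ a b ⊆ region ends x₃ a b := by
  intro v hv
  have hv' := mem_region.1 hv
  rw [mem_region]
  induction hv' with
  | refl => exact ReflTransGen.refl
  | @tail u w hbu huw ih =>
    have hw : w ∈ region ends x₁ a b := mem_region.2 (ReflTransGen.tail hbu huw)
    obtain ⟨⟨e, he⟩, _, _⟩ := huw
    have hu : u ∈ region ends x₁ a b := mem_region.2 hbu
    exact ReflTransGen.tail (ih hu) ⟨⟨e, he⟩, fun hK => h u hK hu, fun hK => h w hK hw⟩

/-- **Equal patterns force equal regions.**  If `b ∉ K_a(x₁)`, `b ∉ K_a(x₂)` and the two colourings agree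
on every edge incident to `Q_b(x₁)` and on every edge incident to `Q_b(x₂)`, then `Q_b(x₁) = Q_b(x₂)`.
[this work] -/
theorem region_eq_of_key {ends : ι → Sym2 V} {x₁ x₂ : ι → Bool} {a b : V}
    (hKb₁ : b ∉ clus ends x₁ false a) (hKb₂ : b ∉ clus ends x₂ false a)
    (h₁₂ : ∀ e u w, ends e = s(u, w) → u ∈ region ends x₁ a b → x₂ e = x₁ e)
    (h₂₁ : ∀ e u w, ends e = s(u, w) → u ∈ region ends x₂ a b → x₁ e = x₂ e) :
    region ends x₁ a b = region ends x₂ a b :=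
  Set.Subset.antisymm
    (region_subset_of_disjoint fun _ hv =>
      clusA_disjoint_region_of_agree (z := x₂) hKb₁ h₁₂ (fun _ he => he) hv)
    (region_subset_of_disjoint fun _ hv =>
      clusA_disjoint_region_of_agree (z := x₁) hKb₂ h₂₁ (fun _ he => he) hv)

variable [Fintype ι] [DecidableEq ι]

/-! ### The four forcing conditions for class-mates of the region-keyed certificate -/

section Forcing

variable {ends : ι → Sym2 V} {a b c : V} {x₁ x₂ : ι → Bool} {T₁ T₂ : Finset ι}

/-- (F1) and (F2).  If `x₁ ∈ L` is `b`-regional (an open `a–b` path all of whose edges are incident to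
`Q_b(x₁)`) and `T₁` contains no edge incident to `Q_b(x₁)`, then the determined-open indicator `dO` of the
cylinder `Z(x₁,x₂)` has `b ∈ O_a(dO) ∖ K_a(dO)`. [this work] -/
theorem dO_mem_tSet_region (hx₁ : x₁ ∈ lSet ends a b c)
    (hreg : ReflTransGen (fun u w => ∃ e, x₁ e = true ∧ ends e = s(u, w) ∧
      (u ∈ region ends x₁ a b ∨ w ∈ region ends x₁ a b)) a b)
    (hT₁ : ∀ e ∈ T₁, ∀ u w, ends e = s(u, w) → u ∉ region ends x₁ a b) :
    (fun e => (decide (e ∉ T₁) && x₁ e) || (decide (e ∈ T₂) && !x₂ e)) ∈ tSet ends a b := by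
  classical
  obtain ⟨_, hKb, _, _, _⟩ := (mem_filter.1 hx₁).2
  set dO : ι → Bool := fun e => (decide (e ∉ T₁) && x₁ e) || (decide (e ∈ T₂) && !x₂ e) with hdO
  refine mem_filter.2 ⟨mem_univ _, ?_, ?_⟩
  · -- (F1): the regional open path is determined-open
    have key : ∀ v, ReflTransGen (fun u w => ∃ e, x₁ e = true ∧ ends e = s(u, w) ∧
        (u ∈ region ends x₁ a b ∨ w ∈ region ends x₁ a b)) a v →
        ReflTransGen (fun u w => w ∈ nbr ends dO true u) a v := by
      intro v hv
      induction hv with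
      | refl => exact ReflTransGen.refl
      | @tail u w _ huw ih =>
        obtain ⟨e, hxe, hends, hinc⟩ := huw
        have heT : e ∉ T₁ := fun h => by
          rcases hinc with hu | hw
          · exact hT₁ e h u w hends hu
          · exact hT₁ e h w u (by rw [hends, Sym2.eq_swap]) hw
        exact ReflTransGen.tail ih ⟨e, by simp [hdO, heT, hxe], hends⟩
    exact key b hreg
  · -- (F2): the complement of `Q_b(x₁)` is closed under `dO`-closed steps from `a`
    have haB : a ∉ region ends x₁ a b :=
      fun h => not_mem_clus_of_region hKb (mem_region.1 h) ReflTransGen.refl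
    have key : ∀ v, ReflTransGen (fun u w => w ∈ nbr ends dO false u) a v → v ∉ region ends x₁ a b := by
      intro v hv
      induction hv with
      | refl => exact haB
      | @tail u w _ huw ih =>
        intro hwB
        obtain ⟨e, hde, hends⟩ := huw
        have heT : e ∉ T₁ := fun h => hT₁ e h w u (by rw [hends, Sym2.eq_swap]) hwB
        have hx₁e : x₁ e = false := by
          cases h : x₁ e
          · rfl
          · exfalso; have : dO e = true := by simp [hdO, heT, h]
            rw [hde] at this; exact Bool.false_ne_true this
        have hwK : w ∉ clus ends x₁ false a := not_mem_clus_of_region hKb (mem_region.1 hwB)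
        have huK : u ∉ clus ends x₁ false a := fun h => hwK (clus_step h ⟨e, hx₁e, hends⟩)
        exact ih (mem_region_step hKb hwB (by rw [hends, Sym2.eq_swap]) huK)
    exact fun h => key b h (mem_region.2 ReflTransGen.refl)

/-- (F3) and (F4).  If `x₁, x₂ ∈ L` have the same region `Q_b`, `T₁` contains only open edges of `x₁`, and
`T₂` consists of the open edges of `x₂` not incident to `Q_b`, then the determined-closed indicator `dK` of
the cylinder `Z(x₁,x₂)` has `c ∈ O_a(dK) ∖ K_a(dK)`. [this work] -/
theorem dK_mem_tSet_region (hx₁ : x₁ ∈ lSet ends a b c) (hx₂ : x₂ ∈ lSet ends a b c)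
    (hQ : region ends x₁ a b = region ends x₂ a b)
    (hT₁ : ∀ e ∈ T₁, x₁ e = true)
    (hT₂ : ∀ e, e ∈ T₂ ↔ x₂ e = true ∧ ∀ u w, ends e = s(u, w) → u ∉ region ends x₂ a b) :
    (fun e => (decide (e ∉ T₁) && !x₁ e) || (decide (e ∈ T₂) && x₂ e)) ∈ tSet ends a c := by
  classical
  obtain ⟨_, hKb₁, _, _, hsep₁⟩ := (mem_filter.1 hx₁).2
  obtain ⟨_, hKb₂, hOc₂, hKc₂, hsep₂⟩ := (mem_filter.1 hx₂).2
  set dK : ι → Bool := fun e => (decide (e ∉ T₁) && !x₁ e) || (decide (e ∈ T₂) && x₂ e) with hdK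
  have hK₁ : clus ends x₁ false a ⊆ clus ends dK true a := by
    refine clus_mono₂ fun e he => ?_
    have : e ∉ T₁ := fun h => by have := hT₁ e h; rw [he] at this; exact Bool.false_ne_true this
    simp [hdK, this, he]
  have hT₂K : ∀ e ∈ T₂, dK e = true := fun e he => by
    have := ((hT₂ e).1 he).1; simp [hdK, he, this]
  refine mem_filter.2 ⟨mem_univ _, ?_, ?_⟩
  · -- (F3): every vertex of `O_a(x₂)` is in the region of `x₁` or in the `dK`-open cluster of `a`
    have key : ∀ v, ReflTransGen (fun u w => w ∈ nbr ends x₂ true u) a v →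
        v ∈ region ends x₁ a b ∨ v ∈ clus ends dK true a := by
      intro v hv
      induction hv with
      | refl => exact Or.inr ReflTransGen.refl
      | @tail u w _ huw ih =>
        obtain ⟨e, hx₂e, hends⟩ := huw
        have regstep : u ∈ region ends x₁ a b → w ∈ region ends x₁ a b ∨ w ∈ clus ends dK true a :=
          fun hu => by
            by_cases hwK : w ∈ clus ends x₁ false a
            · exact Or.inr (hK₁ hwK)
            · exact Or.inl (mem_region_step hKb₁ hu hends hwK)
        rcases ih with hu | hu
        · exact regstep hu
        · by_cases heT : e ∈ T₂
          · exact Or.inr (clus_step hu ⟨e, hT₂K e heT, hends⟩)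
          · -- `e` is open in `x₂` but not flipped: it has an end in the region
            have : ¬ ∀ u' w', ends e = s(u', w') → u' ∉ region ends x₂ a b :=
              fun h => heT ((hT₂ e).2 ⟨hx₂e, h⟩)
            simp only [not_forall, not_not] at this
            obtain ⟨u', w', hends', hu'B⟩ := this
            rw [← hQ] at hu'B
            rw [hends, Sym2.eq_iff] at hends'
            rcases hends' with ⟨rfl, rfl⟩ | ⟨rfl, rfl⟩
            · exact regstep hu'B
            · exact Or.inl hu'B
    rcases key c hOc₂ with h | h
    · exact absurd h hsep₁
    · exact h
  · -- (F4): vertices reachable from `a` by `dK`-closed edges stay in `K_a(x₂) ∪ Q_b(x₂)`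
    have key : ∀ v, ReflTransGen (fun u w => w ∈ nbr ends dK false u) a v →
        v ∈ clus ends x₂ false a ∨ v ∈ region ends x₂ a b := by
      intro v hv
      induction hv with
      | refl => exact Or.inl ReflTransGen.refl
      | @tail u w _ huw ih =>
        obtain ⟨e, hde, hends⟩ := huw
        have heT₂ : ¬ (e ∈ T₂ ∧ x₂ e = true) := by
          rintro ⟨h1, h2⟩
          have : dK e = true := by simp [hdK, h1, h2]
          rw [hde] at this; exact Bool.false_ne_true this
        rcases ih with hu | hu
        · cases hx₂e : x₂ e
          · exact Or.inl (clus_step hu ⟨e, hx₂e, hends⟩)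
          · have heT : e ∉ T₂ := fun h => heT₂ ⟨h, hx₂e⟩
            have : ¬ ∀ u' w', ends e = s(u', w') → u' ∉ region ends x₂ a b :=
              fun h => heT ((hT₂ e).2 ⟨hx₂e, h⟩)
            simp only [not_forall, not_not] at this
            obtain ⟨u', w', hends', hu'B⟩ := this
            rw [hends, Sym2.eq_iff] at hends'
            rcases hends' with ⟨rfl, rfl⟩ | ⟨rfl, rfl⟩
            · exact absurd hu (not_mem_clus_of_region hKb₂ (mem_region.1 hu'B))
            · exact Or.inr hu'B
        · by_cases hwK : w ∈ clus ends x₂ false a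
          · exact Or.inl hwK
          · exact Or.inr (mem_region_step hKb₂ hu hends hwK)
    intro h
    rcases key c h with h' | h'
    · exact hKc₂ h'
    · exact hsep₂ h'

end Forcing

/-! ### The theorem -/

open scoped Classical in
/-- **ANTI₁ for the `b`-regional part of `L`.**  For every finite multigraph `ends : ι → Sym2 V` and
vertices `a, b, c`:  `#{x ∈ L : a is joined to b by open edges incident to Q_b(x)} ≤ #{x : b ∈ O_a∖K_a, c ∈ K_a∖O_a}`.  Proof: the Reimer certificate with
classes = patterns on the edges incident to `Q_b(x)`, flip sets = open edges not incident to `Q_b(x)`, all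
targets `R(b,c)`; (F) by `dO_mem_tSet_region`, `dK_mem_tSet_region` and the forcing lemma; (D) by
decodability of the region (`clusA_disjoint_region_of_agree`, `region_subset_of_disjoint`). [this work] -/
theorem card_filter_regional_le_card_rSet (ends : ι → Sym2 V) (a b c : V) :
    ((lSet ends a b c).filter fun x => ReflTransGen (fun u w => ∃ e, x e = true ∧ ends e = s(u, w) ∧
        (u ∈ region ends x a b ∨ w ∈ region ends x a b)) a b).card
      ≤ (rSet ends a b c).card := by
  classical
  set L' := (lSet ends a b c).filter fun x => ReflTransGen (fun u w => ∃ e, x e = true ∧ ends e = s(u, w) ∧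
        (u ∈ region ends x a b ∨ w ∈ region ends x a b)) a b with hL'
  -- incidence to the region, the class key and the flip sets
  let Inc : (ι → Bool) → ι → Prop := fun x e => ∃ u w, ends e = s(u, w) ∧ u ∈ region ends x a b
  let cls : (ι → Bool) → ι → Option Bool := fun x e => if Inc x e then some (x e) else none
  let T : (ι → Bool) → Finset ι := fun x => univ.filter fun e => x e = true ∧ ¬ Inc x e
  have hT : ∀ x e, e ∈ T x ↔ x e = true ∧ ∀ u w, ends e = s(u, w) → u ∉ region ends x a b := by
    intro x e; simp only [T, Inc, mem_filter, mem_univ, true_and, not_exists, not_and]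
  have hTinc : ∀ x, ∀ e ∈ T x, ∀ u w, ends e = s(u, w) → u ∉ region ends x a b :=
    fun x e he => ((hT x e).1 he).2
  have hTopen : ∀ x, ∀ e ∈ T x, x e = true := fun x e he => ((hT x e).1 he).1
  have hL'mem : ∀ x, x ∈ L' → x ∈ lSet ends a b c ∧ ReflTransGen (fun u w => ∃ e, x e = true ∧
      ends e = s(u, w) ∧ (u ∈ region ends x a b ∨ w ∈ region ends x a b)) a b := fun x hx => mem_filter.1 hx
  have hKb : ∀ x, x ∈ lSet ends a b c → b ∉ clus ends x false a :=
    fun x hx => ((mem_filter.1 hx).2).2.1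
  -- equal keys: equal colours on incident edges, hence equal regions
  have hkey : ∀ x₁ x₂, cls x₁ = cls x₂ → ∀ e u w, ends e = s(u, w) → u ∈ region ends x₁ a b →
      x₂ e = x₁ e := by
    intro x₁ x₂ h e u w hends hu
    have h1 : Inc x₁ e := ⟨u, w, hends, hu⟩
    have := congrFun h e
    simp only [cls, if_pos h1] at this
    by_cases h2 : Inc x₂ e
    · rw [if_pos h2] at this; exact (Option.some_injective _ this).symm
    · rw [if_neg h2] at this; exact absurd this (by simp)
  have hQ : ∀ x₁ ∈ lSet ends a b c, ∀ x₂ ∈ lSet ends a b c, cls x₁ = cls x₂ →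
      region ends x₁ a b = region ends x₂ a b :=
    fun x₁ h₁ x₂ h₂ h => region_eq_of_key (hKb x₁ h₁) (hKb x₂ h₂)
      (fun e u w he hu => hkey x₁ x₂ h e u w he hu) (fun e u w he hu => hkey x₂ x₁ h.symm e u w he hu)
  -- a cylinder point agrees with `x₁` on every edge incident to `Q_b(x₁)` and is closed on `K(x₁)`
  have hagree : ∀ x₁ (z : ι → Bool), (∀ i, i ∉ T x₁ → z i = x₁ i) → ∀ e u w, ends e = s(u, w) →
      u ∈ region ends x₁ a b → z e = x₁ e :=
    fun x₁ z hz e u w he hu => hz e fun heT => hTinc x₁ e heT u w he hu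
  have hclosed : ∀ x₁ (z : ι → Bool), (∀ i, i ∉ T x₁ → z i = x₁ i) → ∀ e, x₁ e = false → z e = false :=
    fun x₁ z hz e he => by
      rw [hz e fun heT => by have := hTopen x₁ e heT; rw [he] at this; exact Bool.false_ne_true this]
      exact he
  refine ReimerCertificate.card_le_of_certificate L' (rSet ends a b c) cls T (fun _ => true) ?_ ?_
  · -- (F): cylinders of class-mates lie in `R(b,c)`
    intro x₁ hx₁ x₂ hx₂ hcls z hz₁ hz₂
    obtain ⟨hx₁L, hreg₁⟩ := hL'mem x₁ hx₁
    obtain ⟨hx₂L, _⟩ := hL'mem x₂ hx₂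
    simp only [ite_true]
    exact cylinder_subset_rSet ends a b c x₁ x₂ (T x₁) (T x₂)
      (dO_mem_tSet_region hx₁L hreg₁ (hTinc x₁))
      (dK_mem_tSet_region hx₁L hx₂L (hQ x₁ hx₁L x₂ hx₂L hcls) (hTopen x₁) (hT x₂)) hz₁ hz₂
  · -- (D): a common cylinder point forces equal regions, then equal patterns
    intro x₁ hx₁ x₂ _ x₃ hx₃ x₄ _ _ _ hne z z' hz₁ _ hz₃ _
    simp only [ite_true]
    intro hzz
    apply hne
    obtain ⟨hx₁L, _⟩ := hL'mem x₁ hx₁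
    obtain ⟨hx₃L, _⟩ := hL'mem x₃ hx₃
    have hQ13 : region ends x₁ a b = region ends x₃ a b := by
      refine Set.Subset.antisymm (region_subset_of_disjoint fun v hv => ?_)
        (region_subset_of_disjoint fun v hv => ?_)
      · exact clusA_disjoint_region_of_agree (z := z) (hKb x₁ hx₁L) (hagree x₁ z hz₁)
          (fun e he => by rw [hzz]; exact hclosed x₃ z' hz₃ e he) hv
      · exact clusA_disjoint_region_of_agree (z := z) (hKb x₃ hx₃L)
          (fun e u w he hu => by rw [hzz]; exact hagree x₃ z' hz₃ e u w he hu)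
          (hclosed x₁ z hz₁) hv
    funext e
    by_cases h1 : Inc x₁ e
    · obtain ⟨u, w, he, hu⟩ := h1
      have hu3 : u ∈ region ends x₃ a b := hQ13 ▸ hu
      have h3 : Inc x₃ e := ⟨u, w, he, hu3⟩
      have hz1 := hagree x₁ z hz₁ e u w he hu
      have hz3 := hagree x₃ z' hz₃ e u w he hu3
      rw [hzz] at hz1
      simp only [cls, if_pos (show Inc x₁ e from ⟨u, w, he, hu⟩), if_pos h3, ← hz1, ← hz3]
    · have h3 : ¬ Inc x₃ e := fun ⟨u, w, he, hu⟩ => h1 ⟨u, w, he, hQ13 ▸ hu⟩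
      simp only [cls, if_neg h1, if_neg h3]

open scoped Classical in
/-- If `a ~ b`, every element of `L` is `b`-regional: the edge `ab` is open (else `b ∈ K_a`) and incident
to `b ∈ Q_b(x)`. [this work] -/
theorem lSet_filter_regional_eq_of_adj (ends : ι → Sym2 V) {a b c : V} (hab : ∃ e, ends e = s(a, b)) :
    ((lSet ends a b c).filter fun x => ReflTransGen (fun u w => ∃ e, x e = true ∧ ends e = s(u, w) ∧
        (u ∈ region ends x a b ∨ w ∈ region ends x a b)) a b) = lSet ends a b c := by
  classical
  refine filter_true_of_mem fun x hx => ?_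
  obtain ⟨_, hKb, _, _, _⟩ := (mem_filter.1 hx).2
  obtain ⟨e, he⟩ := hab
  have hxe : x e = true := by
    cases h : x e
    · exact absurd (ReflTransGen.single ⟨e, h, he⟩) hKb
    · rfl
  have hb : b ∈ region ends x a b := mem_region.2 ReflTransGen.refl
  exact ReflTransGen.single ⟨e, hxe, he, Or.inr hb⟩

/- Remark: rewriting with `lSet_filter_regional_eq_of_adj` in `card_filter_regional_le_card_rSet` gives
gen 74's `card_lSet_le_card_rSet_of_adj_left` (ANTI₁ when `a ~ b`); not restated here (already landed). -/

end AntipodalR1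

end Summit.CriticalPhenomena.PercolationContinuityZ3.Theorems
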